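import Summits.QuantumFields.BalabanUV.Beta.GAN24.T2DevConservationDriftRows
import Summits.QuantumFields.BalabanUV.Beta.GAN24.T2DevConservationEnd
import Summits.QuantumFields.BalabanUV.Beta.GAN24.T2DeviationDrift
import Summits.QuantumFields.BalabanUV.Beta.GAN24.KSlotAssembly
import Summits.QuantumFields.BalabanUV.Beta.GAN24.WrecAtSlotRowsFinal

/-!
# `BalabanUV.Beta.GAN24.T2DevConservationDrift` — binder row G-an2-4 / (CONV-C), W-slot CT-W, route «WC-TL» (RULING R-gan24p1-g24-1), A-0 in DEVIATION FORM, **THE DRIFT TWIN**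
# of `T2DevConservationEnd` (the OWNER gan24-p1 g24, l.38843 (iii): «GO, THIS SHAPE … plus its drift twin when convenient»; this lineage's INTENT I-leaf01-g63-1, journal l.39137):
# **«T2Drift» OF an2's COMB T₂ TOWER AT `d = 3` FROM FIVE DISPLAYED ROWS (U) ∧ (U-drift) ∧ (C) ∧ (H) ∧ (H-rate)**, via the OWNER's generic socket
# `T2DeviationDrift.drift_of_dev_rows` at `T := T_·` (undressed-kernel comb-slot tower), `T′ := T̃_·` (dressed comb tower), `A := 𝒜^B` (road W3's undressed `lin4` family),
# `g := h`, `Zfree := ZfreeSym`, `mom := 0`; then the JOINT PAIR («T2Shape», «T2Drift») at one rate and — by p2's `WrecAtSlotRowsFinal.hW_hWall_WrecAt_three_of_T2` — the two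
# W-slot rows (hW, hWall) of the comb family from the five rows.

NOT IN PRINT; OUR BOOKKEEPING ([folklore] composition BY NAME; G-an2-4 formalisation swarm, leaf prover `b2b-balaban-gan24-formalise-leaf-01`, gen 63).  HONEST FRAMING (cell contract,
verbatim): «discharging `BetaPertH` makes Bałaban's UV stability UNCONDITIONAL — a real constructive-QFT result; it is NOT the continuum limit and NOT the Clay problem.»  HONEST
DEPENDENCY (verbatim): «continuum YM on T⁴ ⇐ BetaPertH ∧ nine spine estimates (0/9 proved); BetaPertH ⇐ (D1) ∧ (D4) ∧ CAP+tail; G-an2-4 gates asym, D1 and NE2/3/4.»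

## Objects (as in `T2DevConservationLedger` ∕ `…End`): `T̃_j` the dressed comb tower `unitS₂_j (T2RecAt d Lc ρ … j)`, `T_j` the undressed-kernel comb-slot tower, `D_j := T̃_j − T_j`,
## `𝒜^B_j := lin4 c₄ (unitK_j (KInvStep Lc j)) Lc`, `h_j := (𝒜^E_j T̃_j − 𝒜^B_j T̃_j) + (b̃_j − b_j)`; the socket's forcing `f_m := (𝒜^B_{m+1} D_m − 𝒜^B_m D_m) + (h_{m+1} − h_m)`.
* §1 = the companion `T2DevConservationDriftRows` (generic tables): `zfreeSym_forcing` (the socket's `hZf` row — the transport DIFFERENCE of ANY jointly covariant `LocStencil₂`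
  table is `ZfreeSym`, NO charge hypothesis; `±`-closure of the `ZfreeSym` text) and `exists_forcing_rate` (the socket's `hf` row through leaf-03's `TransportStepLipschitz.lin_cauchy`).
* §2 (`d = 3`) **`t2Drift_T2RecAt_three_of_U_Ud_C_H_Hr`**: `2 ≤ Lc`, every in-block root `r`, every `cE cVH cΛ cB Tc`, the pin `|cE₂| ≤ Lc^8`, every jointly `Lc`-covariant
  off-diagonal `LocStencil₂` border; rows **(U)** `∀ n, LocStencil₂ (T_n) C₂ δ₂`, **(U-drift)** `∀ n, LocStencil₂ (T_{n+1} − T_n) (cU·ϑU^n) δU` (`0 ≤ cU`, `0 ≤ ϑU < 1`, `0 < δU`) = the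
  OWNER's `hU` quintuple at `T := T_·` (leaf-04's `T2UndressedCombDriftEnd.exists_hU_three_of_F2a_pinEq`, staged, supplies it from F2a-comb ∧ the exact pin), **(C)** the SYMMETRISED
  relative conservation law `zmodeSym Lc (T̃_i) = zmodeSym Lc (T_i)` ∀ i (an2 WANTED), **(H)** `∀ m, LocStencil₂ (h_m) Ch δh`, **(H-rate)** `∀ m, LocStencil₂ (h_{m+1} − h_m) (Ch′·θh^m) δh′`
  (`0 ≤ θh < 1`, `0 < δh′`) ⟹ `∃ c ϑ δ, 0 ≤ c ∧ 0 < ϑ ∧ ϑ < 1 ∧ 0 < δ ∧ ∀ n, LocStencil₂ (T̃_{n+1} − T̃_n) (c·ϑ^n) δ`.  Inside, BY NAME: `hAP ∕ hAadd` = `T2UnitSplitFrom.lin4_bdd₄ ∕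
  lin4_add_bdd₄`, `hrec` = `T2DevConservationLedger.devB_comb_succ`, `h0` = `T2DevShapes.dev_comb_zero`, `hT′` = «T2Shape»(E) by `T2DevConservationEnd.t2Shape_T2RecAt_three_of_U_C_H`
  from (U)(C)(H), `hf` = §1 `exists_forcing_rate` over `KSlotAssembly.convCKWall_holds`, `hZf` = §1 `zfreeSym_forcing` with `zfreeSym_h_of_conservedSym` at `m, m+1`, `hg0 ∕ hZg0` =
  (H) ∧ (C) at `0`, `hTirrE` = road W3's `TransportRows.transport_rows_three_symZ` (`ρ = Lc⁻¹`).
* §3 **`exists_hT₂_hT₂d_T2RecAt_three_of_rows`** (the pair `hT₂ ∕ hT₂d` of p2's `WrecAtSlotRowsFinal.hW_hWall_WrecAt_three_of_T2` at ONE rate, `WSlotT2OfPieces.cauchy_of_rate`) and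
  **`hW_hWall_WrecAt_three_of_rows`** (`cE = Lc⁴`): (hW, hWall) OF THE COMB FAMILY ⟸ the five rows.
ROWS (H) ∕ (H-rate) read the ORBIT member through `𝒜^B_m ((𝔇 − 1) T̃_m)` — circular as stand-alone estimates (OWNER W1 l.38686); under RULING R-gan24p1-g24-1 («WC-TL») their located
supplier chain is (SLAVE) T-EQ ∘ an2's table laws (leaf-03 `Lin4SlotDivergence` ✓, leaf-06 «SLAVE-src») + (Q-R) j-uniform Ward-locus remainder bounds + (Q-b) source rows, and for
(H-rate) their RATE faces (`h_j = q_j − b_j`; `b`'s Cauchy row is TREE, `T2UndressedCombShapeEnd.source_rows_three_holds`) — NONE of which is proved here; this file DISPLAYS the rows.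
CONDITIONAL on the five rows; asserts NO shape of Bałaban's tables and NO value of any charge; NOTHING of (hW, hWall) discharged unconditionally; NOT «W-slot closed», NEVER «G-an2-4
closed» as (CONV-C); NOT D1, NOT `BetaPertH`, NOT continuum, NOT Clay.  0 cited facts, 0 `def`, 0 `def … : Prop`, 0 sorry.  2026-08-22.
-/

noncomputable section

open Finset
open scoped BigOperators
open Literature.MathematicalPhysics.QuantumFieldTheory
open Literature.MathematicalPhysics.QuantumFieldTheory.Balaban1983to89
open Literature.MathematicalPhysics.QuantumFieldTheory.Balaban1983to89.Beta
open ExpKernelCalculus (MKer Decays BiLoc VertexFamily VertexFamily₂ shiftK)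
open OneStepResolventKernel (Fib LocStencil decays_mono)
open OneStepKernelFamily (KInvStep decays_KInvStep shiftK_KInvStep)
open AffineAveraging (box toSite)
open AveragingMixedJetTables (mixFFAt mixFFAt_translate)
open SecondOrderResponse (W2SymOfK LocStencilFM cBi)
open BalabanCompositeJets (LocStencil₂)
open BalabanStepJetsSucc (mmRead)
open BalabanStepW2 (K3OfK M2Of)
open Summit.QuantumFields.BalabanUV.Beta.HessKerDressedUnits (unitK unitS unitW decays_unitK)
open Summit.QuantumFields.BalabanUV.Beta.SecondOrderUnits (unitM unitS₂ unitM₂)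
open Summit.QuantumFields.BalabanUV.Beta.AxialDressingRooted (coDressKBmAt dressKBmAt coProjBmAtK decays_coDressKBmAt_KInvStep)
open Summit.QuantumFields.BalabanUV.Beta.SpineRooted (T2RecOf T2RecAt SpureRecAt M1At WrecAt)
open Summit.QuantumFields.BalabanUV.Beta.GAN24.CombesThomas (sfStep smStep UnitDecayK CauchyDecayK)
open Summit.QuantumFields.BalabanUV.Beta.GAN24.T2RecursionAffine (lin4)
open Summit.QuantumFields.BalabanUV.Beta.GAN24.BiStencilZeroMode (Tab zmode)
open Summit.QuantumFields.BalabanUV.Beta.GAN24.Push4Iter (BiTab)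
open Summit.QuantumFields.BalabanUV.Beta.GAN24.AffineUnroll (transport)
open Summit.QuantumFields.BalabanUV.Beta.GAN24.T2UnitSplitFrom (lin4_bdd₄ lin4_add_bdd₄)
open Summit.QuantumFields.BalabanUV.Beta.GAN24.WSlotForcingZeroMode (locStencil₂_sub)
open Summit.QuantumFields.BalabanUV.Beta.GAN24.WSlotT2OfPieces (cauchy_of_rate)
open Summit.QuantumFields.BalabanUV.Beta.GAN24.T2DevShapes (dev_comb_zero)
open Summit.QuantumFields.BalabanUV.Beta.GAN24.T2DevConservationDriftRows (zfreeSym_forcing exists_forcing_rate)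
open Summit.QuantumFields.BalabanUV.Beta.GAN24.T2DevCovariance (dev_comb_translate)
open Summit.QuantumFields.BalabanUV.Beta.GAN24.T2DevConservationLedger (devB_comb_succ)
open Summit.QuantumFields.BalabanUV.Beta.GAN24.T2DevConservationEnd (zfreeSym_h_of_conservedSym t2Shape_T2RecAt_three_of_U_C_H)
open Summit.QuantumFields.BalabanUV.Beta.GAN24.T2DeviationDrift (drift_of_dev_rows)
open Summit.QuantumFields.BalabanUV.Beta.GAN24.KSlotAssembly (convCKWall_holds)
open Summit.QuantumFields.BalabanUV.Beta.GAN24.TransportRows (transport_rows_three_symZ inv_natCast_nonneg inv_natCast_lt_one)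
open Summit.QuantumFields.BalabanUV.Beta.GAN24.WrecAtSlotRowsFinal (hW_hWall_WrecAt_three_of_T2)

namespace Summit.QuantumFields.BalabanUV.Beta.GAN24.T2DevConservationDrift

/-! ## §2 The DRIFT END at `d = 3`: «T2Drift» of the comb tower from (U) ∧ (U-drift) ∧ (C) ∧ (H) ∧ (H-rate) -/

section End

variable {Lc : ℕ} [NeZero Lc] {r : Fin (3 + 1) → ℕ}

/-- NOT IN PRINT; OUR PROOF ATTEMPT ([folklore] the OWNER gan24-p1's `T2DeviationDrift.drift_of_dev_rows` at `T := T_·`, `T′ := T̃_·`, `A := 𝒜^B`, `g := h`, `Zfree := ZfreeSym`,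
`mom := 0`, every slot filled BY NAME — see the module docstring).  **«T2Drift» OF an2's COMB T₂ TOWER AT `d = 3` FROM (U) ∧ (U-drift) ∧ (C) ∧ (H) ∧ (H-rate)** (`2 ≤ Lc`, every
in-block root `r`, every `cE cVH cΛ cB Tc`, the pin `|cE₂| ≤ Lc^8`, every jointly `Lc`-covariant off-diagonal `LocStencil₂` border `vh₂S`): **(U)** `∀ n, LocStencil₂ (T_n) C₂ δ₂`,
**(U-drift)** `∀ n, LocStencil₂ (T_{n+1} − T_n) (cU·ϑU^n) δU` with `0 ≤ cU`, `0 ≤ ϑU < 1`, `0 < δU` (the OWNER's `hU` quintuple for the undressed-kernel comb-slot tower — leaf-04's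
(U-drift) END supplies it from F2a-comb ∧ the exact pin), **(C)** `∀ i κ κ′ κ₁ κ₂, zmodeSym Lc (T̃_i) = zmodeSym Lc (T_i)`, **(H)** `∀ m, LocStencil₂ (h_m) Ch δh`, **(H-rate)**
`∀ m, LocStencil₂ (h_{m+1} − h_m) (Ch′·θh^m) δh′` with `0 ≤ θh < 1`, `0 < δh′` ⟹ `∃ c ϑ δ, 0 ≤ c ∧ 0 < ϑ ∧ ϑ < 1 ∧ 0 < δ ∧ ∀ n, LocStencil₂ (T̃_{n+1} − T̃_n) (c·ϑ^n) δ`.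
ROWS (H) ∕ (H-rate) read the member (`h_m ∋ 𝒜^B_m ((𝔇 − 1) T̃_m)`) — circular as stand-alone estimates; their located supplier chain under «WC-TL» is (SLAVE) + (Q-R) + (Q-b) and its
RATE faces — DISPLAYED here, not asserted.  CONDITIONAL on the five rows; NOT «W-slot closed»; NEVER «G-an2-4 closed» as (CONV-C); NOT D1, NOT `BetaPertH`, NOT continuum, NOT Clay. -/
theorem t2Drift_T2RecAt_three_of_U_Ud_C_H_Hr (hLc : 2 ≤ Lc) (hr : r ∈ box (3 + 1) Lc) (cE cVH cΛ cE₂ cB : ℝ) (Tc : Fin 4 → Fin 4 → Fin 4 → Fin 4 → ℝ)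
    {vh₂S : Tab 3}
    (hBff : ∀ κ u κ' u' x z (α β : Fin (3 + 1)), vh₂S κ u κ' u' x z (Sum.inl α) (Sum.inl β) = 0)
    (hBmm : ∀ κ u κ' u' x z (μ ν : Fin (3 + 1)), vh₂S κ u κ' u' x z (Sum.inr μ) (Sum.inr ν) = 0)
    (hB : ∃ C δ : ℝ, 0 < δ ∧ LocStencil₂ vh₂S C δ)
    (hBt : ∀ (κ : Fin (3 + 1)) (u : Fin (3 + 1) → ℤ) (κ' : Fin (3 + 1)) (u' t : Fin (3 + 1) → ℤ),
      vh₂S κ (u + (Lc : ℤ) • t) κ' (u' + (Lc : ℤ) • t) = shiftK (-((Lc : ℤ) • t)) (vh₂S κ u κ' u'))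
    (hpin : |cE₂| ≤ (Lc : ℝ) ^ (2 * (3 + 1))) {C₂ δ₂ Ch δh cU ϑU δU Ch' θh δh' : ℝ} (hδ₂ : 0 < δ₂) (hδh : 0 < δh)
    (hU : ∀ n : ℕ, LocStencil₂ (unitS₂ (sfStep Lc n) (smStep 3 Lc n) (T2RecOf 3 Lc (fun j => KInvStep (d := 3) Lc j) (SpureRecAt 3 Lc (toSite r) cE cVH cΛ) (M1At 3 Lc (toSite r) cΛ) cE₂ cB Tc vh₂S (mixFFAt (toSite r) Lc) n)) C₂ δ₂)
    (hUd : ∀ n : ℕ, LocStencil₂ ((unitS₂ (sfStep Lc (n + 1)) (smStep 3 Lc (n + 1)) (T2RecOf 3 Lc (fun j => KInvStep (d := 3) Lc j) (SpureRecAt 3 Lc (toSite r) cE cVH cΛ) (M1At 3 Lc (toSite r) cΛ) cE₂ cB Tc vh₂S (mixFFAt (toSite r) Lc) (n + 1))) - (unitS₂ (sfStep Lc n) (smStep 3 Lc n) (T2RecOf 3 Lc (fun j => KInvStep (d := 3) Lc j) (SpureRecAt 3 Lc (toSite r) cE cVH cΛ) (M1At 3 Lc (toSite r) cΛ) cE₂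 cB Tc vh₂S (mixFFAt (toSite r) Lc) n))) (cU * ϑU ^ n) δU)
    (hcU : 0 ≤ cU) (hϑU0 : 0 ≤ ϑU) (hϑU1 : ϑU < 1) (hδU : 0 < δU)
    (hC : ∀ (i : ℕ) (κ κ' κ₁ κ₂ : Fin (3 + 1)),
      zmode Lc (unitS₂ (sfStep Lc i) (smStep 3 Lc i) (T2RecAt 3 Lc (toSite r) cE cVH cΛ cE₂ cB Tc vh₂S (mixFFAt (toSite r) Lc) i)) κ κ' (Sum.inl κ₁) (Sum.inl κ₂)
          + zmode Lc (unitS₂ (sfStep Lc i) (smStep 3 Lc i) (T2RecAt 3 Lc (toSite r) cE cVH cΛ cE₂ cB Tc vh₂S (mixFFAt (toSite r) Lc) i)) κ' κ (Sum.inl κ₁) (Sum.inl κ₂)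
        = zmode Lc (unitS₂ (sfStep Lc i) (smStep 3 Lc i) (T2RecOf 3 Lc (fun j => KInvStep (d := 3) Lc j) (SpureRecAt 3 Lc (toSite r) cE cVH cΛ) (M1At 3 Lc (toSite r) cΛ) cE₂ cB Tc vh₂S (mixFFAt (toSite r) Lc) i)) κ κ' (Sum.inl κ₁) (Sum.inl κ₂)
          + zmode Lc (unitS₂ (sfStep Lc i) (smStep 3 Lc i) (T2RecOf 3 Lc (fun j => KInvStep (d := 3) Lc j) (SpureRecAt 3 Lc (toSite r) cE cVH cΛ) (M1At 3 Lc (toSite r) cΛ) cE₂ cB Tc vh₂S (mixFFAt (toSite r) Lc) i)) κ' κ (Sum.inl κ₁) (Sum.inl κ₂))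
    (hH : ∀ m : ℕ, LocStencil₂ (((lin4 (cE₂ * (Lc : ℝ) ^ (2 * (3 + 1))) (unitK (sfStep Lc m) (smStep 3 Lc m) (coDressKBmAt (toSite r) Lc (KInvStep (d := 3) Lc m))) Lc
            (unitS₂ (sfStep Lc m) (smStep 3 Lc m) (T2RecAt 3 Lc (toSite r) cE cVH cΛ cE₂ cB Tc vh₂S (mixFFAt (toSite r) Lc) m)) -
          lin4 (cE₂ * (Lc : ℝ) ^ (2 * (3 + 1))) (unitK (sfStep Lc m) (smStep 3 Lc m) (KInvStep (d := 3) Lc m)) Lc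
            (unitS₂ (sfStep Lc m) (smStep 3 Lc m) (T2RecAt 3 Lc (toSite r) cE cVH cΛ cE₂ cB Tc vh₂S (mixFFAt (toSite r) Lc) m))) +
        ((fun κ u κ' u' => (cE₂ * (Lc : ℝ) ^ (2 * (3 + 1))) • mmRead Lc (K3OfK (unitK (sfStep Lc m) (smStep 3 Lc m) (coDressKBmAt (toSite r) Lc (KInvStep (d := 3) Lc m))) Lc
            (unitS (sfStep Lc m) (smStep 3 Lc m) (SpureRecAt 3 Lc (toSite r) cE cVH cΛ m)) (unitM (sfStep Lc m) (smStep 3 Lc m) (M1At 3 Lc (toSite r) cΛ m))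
            (W2SymOfK (unitK (sfStep Lc m) (smStep 3 Lc m) (coDressKBmAt (toSite r) Lc (KInvStep (d := 3) Lc m))) Lc (unitS (sfStep Lc m) (smStep 3 Lc m) (SpureRecAt 3 Lc (toSite r) cE cVH cΛ m))
              (unitM (sfStep Lc m) (smStep 3 Lc m) (M1At 3 Lc (toSite r) cΛ m)) 0 (unitM₂ (sfStep Lc m) (smStep 3 Lc m) (M2Of 3 Lc (mixFFAt (toSite r) Lc) m))) κ u κ' u')
          + cB • vh₂S κ u κ' u') -
         (fun κ u κ' u' => (cE₂ * (Lc : ℝ) ^ (2 * (3 + 1))) • mmRead Lc (K3OfK (unitK (sfStep Lc m) (smStep 3 Lc m) (KInvStep (d := 3) Lc m)) Lc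
            (unitS (sfStep Lc m) (smStep 3 Lc m) (SpureRecAt 3 Lc (toSite r) cE cVH cΛ m)) (unitM (sfStep Lc m) (smStep 3 Lc m) (M1At 3 Lc (toSite r) cΛ m))
            (W2SymOfK (unitK (sfStep Lc m) (smStep 3 Lc m) (KInvStep (d := 3) Lc m)) Lc (unitS (sfStep Lc m) (smStep 3 Lc m) (SpureRecAt 3 Lc (toSite r) cE cVH cΛ m))
              (unitM (sfStep Lc m) (smStep 3 Lc m) (M1At 3 Lc (toSite r) cΛ m)) 0 (unitM₂ (sfStep Lc m) (smStep 3 Lc m) (M2Of 3 Lc (mixFFAt (toSite r) Lc) m))) κ u κ' u')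
          + cB • vh₂S κ u κ' u')))) Ch δh)
    (hHr : ∀ m : ℕ, LocStencil₂ ((((lin4 (cE₂ * (Lc : ℝ) ^ (2 * (3 + 1))) (unitK (sfStep Lc (m + 1)) (smStep 3 Lc (m + 1)) (coDressKBmAt (toSite r) Lc (KInvStep (d := 3) Lc (m + 1)))) Lc
            (unitS₂ (sfStep Lc (m + 1)) (smStep 3 Lc (m + 1)) (T2RecAt 3 Lc (toSite r) cE cVH cΛ cE₂ cB Tc vh₂S (mixFFAt (toSite r) Lc) (m + 1))) -
          lin4 (cE₂ * (Lc : ℝ) ^ (2 * (3 + 1))) (unitK (sfStep Lc (m + 1)) (smStep 3 Lc (m + 1)) (KInvStep (d := 3) Lc (m + 1))) Lc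
            (unitS₂ (sfStep Lc (m + 1)) (smStep 3 Lc (m + 1)) (T2RecAt 3 Lc (toSite r) cE cVH cΛ cE₂ cB Tc vh₂S (mixFFAt (toSite r) Lc) (m + 1)))) +
        ((fun κ u κ' u' => (cE₂ * (Lc : ℝ) ^ (2 * (3 + 1))) • mmRead Lc (K3OfK (unitK (sfStep Lc (m + 1)) (smStep 3 Lc (m + 1)) (coDressKBmAt (toSite r) Lc (KInvStep (d := 3) Lc (m + 1)))) Lc
            (unitS (sfStep Lc (m + 1)) (smStep 3 Lc (m + 1)) (SpureRecAt 3 Lc (toSite r) cE cVH cΛ (m + 1))) (unitM (sfStep Lc (m + 1)) (smStep 3 Lc (m + 1)) (M1At 3 Lc (toSite r) cΛ (m + 1)))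
            (W2SymOfK (unitK (sfStep Lc (m + 1)) (smStep 3 Lc (m + 1)) (coDressKBmAt (toSite r) Lc (KInvStep (d := 3) Lc (m + 1)))) Lc (unitS (sfStep Lc (m + 1)) (smStep 3 Lc (m + 1)) (SpureRecAt 3 Lc (toSite r) cE cVH cΛ (m + 1)))
              (unitM (sfStep Lc (m + 1)) (smStep 3 Lc (m + 1)) (M1At 3 Lc (toSite r) cΛ (m + 1))) 0 (unitM₂ (sfStep Lc (m + 1)) (smStep 3 Lc (m + 1)) (M2Of 3 Lc (mixFFAt (toSite r) Lc) (m + 1)))) κ u κ' u')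
          + cB • vh₂S κ u κ' u') -
         (fun κ u κ' u' => (cE₂ * (Lc : ℝ) ^ (2 * (3 + 1))) • mmRead Lc (K3OfK (unitK (sfStep Lc (m + 1)) (smStep 3 Lc (m + 1)) (KInvStep (d := 3) Lc (m + 1))) Lc
            (unitS (sfStep Lc (m + 1)) (smStep 3 Lc (m + 1)) (SpureRecAt 3 Lc (toSite r) cE cVH cΛ (m + 1))) (unitM (sfStep Lc (m + 1)) (smStep 3 Lc (m + 1)) (M1At 3 Lc (toSite r) cΛ (m + 1)))
            (W2SymOfK (unitK (sfStep Lc (m + 1)) (smStep 3 Lc (m + 1)) (KInvStep (d := 3) Lc (m + 1))) Lc (unitS (sfStep Lc (m + 1)) (smStep 3 Lc (m + 1)) (SpureRecAt 3 Lc (toSite r) cE cVH cΛ (m + 1)))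
              (unitM (sfStep Lc (m + 1)) (smStep 3 Lc (m + 1)) (M1At 3 Lc (toSite r) cΛ (m + 1))) 0 (unitM₂ (sfStep Lc (m + 1)) (smStep 3 Lc (m + 1)) (M2Of 3 Lc (mixFFAt (toSite r) Lc) (m + 1)))) κ u κ' u')
          + cB • vh₂S κ u κ' u')))) -
      (((lin4 (cE₂ * (Lc : ℝ) ^ (2 * (3 + 1))) (unitK (sfStep Lc m) (smStep 3 Lc m) (coDressKBmAt (toSite r) Lc (KInvStep (d := 3) Lc m))) Lc
            (unitS₂ (sfStep Lc m) (smStep 3 Lc m) (T2RecAt 3 Lc (toSite r) cE cVH cΛ cE₂ cB Tc vh₂S (mixFFAt (toSite r) Lc) m)) -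
          lin4 (cE₂ * (Lc : ℝ) ^ (2 * (3 + 1))) (unitK (sfStep Lc m) (smStep 3 Lc m) (KInvStep (d := 3) Lc m)) Lc
            (unitS₂ (sfStep Lc m) (smStep 3 Lc m) (T2RecAt 3 Lc (toSite r) cE cVH cΛ cE₂ cB Tc vh₂S (mixFFAt (toSite r) Lc) m))) +
        ((fun κ u κ' u' => (cE₂ * (Lc : ℝ) ^ (2 * (3 + 1))) • mmRead Lc (K3OfK (unitK (sfStep Lc m) (smStep 3 Lc m) (coDressKBmAt (toSite r) Lc (KInvStep (d := 3) Lc m))) Lc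
            (unitS (sfStep Lc m) (smStep 3 Lc m) (SpureRecAt 3 Lc (toSite r) cE cVH cΛ m)) (unitM (sfStep Lc m) (smStep 3 Lc m) (M1At 3 Lc (toSite r) cΛ m))
            (W2SymOfK (unitK (sfStep Lc m) (smStep 3 Lc m) (coDressKBmAt (toSite r) Lc (KInvStep (d := 3) Lc m))) Lc (unitS (sfStep Lc m) (smStep 3 Lc m) (SpureRecAt 3 Lc (toSite r) cE cVH cΛ m))
              (unitM (sfStep Lc m) (smStep 3 Lc m) (M1At 3 Lc (toSite r) cΛ m)) 0 (unitM₂ (sfStep Lc m) (smStep 3 Lc m) (M2Of 3 Lc (mixFFAt (toSite r) Lc) m))) κ u κ' u')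
          + cB • vh₂S κ u κ' u') -
         (fun κ u κ' u' => (cE₂ * (Lc : ℝ) ^ (2 * (3 + 1))) • mmRead Lc (K3OfK (unitK (sfStep Lc m) (smStep 3 Lc m) (KInvStep (d := 3) Lc m)) Lc
            (unitS (sfStep Lc m) (smStep 3 Lc m) (SpureRecAt 3 Lc (toSite r) cE cVH cΛ m)) (unitM (sfStep Lc m) (smStep 3 Lc m) (M1At 3 Lc (toSite r) cΛ m))
            (W2SymOfK (unitK (sfStep Lc m) (smStep 3 Lc m) (KInvStep (d := 3) Lc m)) Lc (unitS (sfStep Lc m) (smStep 3 Lc m) (SpureRecAt 3 Lc (toSite r) cE cVH cΛ m))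
              (unitM (sfStep Lc m) (smStep 3 Lc m) (M1At 3 Lc (toSite r) cΛ m)) 0 (unitM₂ (sfStep Lc m) (smStep 3 Lc m) (M2Of 3 Lc (mixFFAt (toSite r) Lc) m))) κ u κ' u')
          + cB • vh₂S κ u κ' u'))))) (Ch' * θh ^ m) δh')
    (hθh0 : 0 ≤ θh) (hθh1 : θh < 1) (hδh' : 0 < δh') :
    ∃ c ϑ δ : ℝ, 0 ≤ c ∧ 0 < ϑ ∧ ϑ < 1 ∧ 0 < δ ∧
      ∀ n : ℕ, LocStencil₂ ((unitS₂ (sfStep Lc (n + 1)) (smStep 3 Lc (n + 1)) (T2RecAt 3 Lc (toSite r) cE cVH cΛ cE₂ cB Tc vh₂S (mixFFAt (toSite r) Lc) (n + 1))) - (unitS₂ (sfStep Lc n) (smStep 3 Lc n) (T2RecAt 3 Lc (toSite r) cE cVH cΛ cE₂ cB Tc vh₂S (mixFFAt (toSite r) Lc) n))) (c * ϑ ^ n) δ := by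
  have hLc1 : 1 ≤ Lc := le_trans (by norm_num) hLc
  -- «T2Shape»(E) from (U) ∧ (C) ∧ (H): this lineage's A-0 END
  obtain ⟨C₂', δ₂', hδ₂', hT'⟩ := t2Shape_T2RecAt_three_of_U_C_H hLc hr cE cVH cΛ cE₂ cB Tc hBff hBmm hB hBt hpin hδ₂ hδh hU hC hH
  -- the deviation: uniform shape and joint covariance
  have hδD : 0 < min δ₂' δ₂ := lt_min hδ₂' hδ₂
  have hD : ∀ m : ℕ, LocStencil₂ ((unitS₂ (sfStep Lc m) (smStep 3 Lc m) (T2RecAt 3 Lc (toSite r) cE cVH cΛ cE₂ cB Tc vh₂S (mixFFAt (toSite r) Lc) m)) - (unitS₂ (sfStep Lc m) (smStep 3 Lc m) (T2RecOf 3 Lc (fun j => KInvStep (d := 3) Lc j) (SpureRecAt 3 Lc (toSite r) cE cVH cΛ) (M1At 3 Lc (toSite r) cΛ) cE₂ cB Tc vh₂S (mixFFAt (toSite r) Lc) m))) (C₂' + |(-1 : ℝ)| * C₂) (min δ₂' δ₂) :=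
    fun m => locStencil₂_sub ((hT' m).mono (min_le_left _ _)) ((hU m).mono (min_le_right _ _))
  have hDcov : ∀ (m : ℕ) κ u κ' u' t, ((unitS₂ (sfStep Lc m) (smStep 3 Lc m) (T2RecAt 3 Lc (toSite r) cE cVH cΛ cE₂ cB Tc vh₂S (mixFFAt (toSite r) Lc) m)) - (unitS₂ (sfStep Lc m) (smStep 3 Lc m) (T2RecOf 3 Lc (fun j => KInvStep (d := 3) Lc j) (SpureRecAt 3 Lc (toSite r) cE cVH cΛ) (M1At 3 Lc (toSite r) cΛ) cE₂ cB Tc vh₂S (mixFFAt (toSite r) Lc) m))) κ (u + (Lc : ℤ) • t) κ' (u' + (Lc : ℤ) • t)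
      = shiftK (-((Lc : ℤ) • t)) (((unitS₂ (sfStep Lc m) (smStep 3 Lc m) (T2RecAt 3 Lc (toSite r) cE cVH cΛ cE₂ cB Tc vh₂S (mixFFAt (toSite r) Lc) m)) - (unitS₂ (sfStep Lc m) (smStep 3 Lc m) (T2RecOf 3 Lc (fun j => KInvStep (d := 3) Lc j) (SpureRecAt 3 Lc (toSite r) cE cVH cΛ) (M1At 3 Lc (toSite r) cΛ) cE₂ cB Tc vh₂S (mixFFAt (toSite r) Lc) m))) κ u κ' u') :=
    fun m κ u κ' u' t => dev_comb_translate hLc1 cE cVH cΛ cE₂ cB Tc hBt m κ u κ' u' t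
  -- road P1's K-slot rows; the forcing's RATE row; road W3's transport rows at the common input rate
  obtain ⟨CK, δK, cK, θK, hδK, hθK0, hθK1, hK, hKall⟩ := convCKWall_holds (Lc := Lc) hLc
  have hCK : 0 ≤ CK := (hK 0).nonneg (Sum.inl 0)
  obtain ⟨Cf, θf, δf, hCf, hθf0, hθf1, hδf, hf⟩ := exists_forcing_rate (d := 3) hLc1 (cE₂ * (Lc : ℝ) ^ (2 * (3 + 1)))
    (fun m => (unitS₂ (sfStep Lc m) (smStep 3 Lc m) (T2RecAt 3 Lc (toSite r) cE cVH cΛ cE₂ cB Tc vh₂S (mixFFAt (toSite r) Lc) m)) - (unitS₂ (sfStep Lc m) (smStep 3 Lc m) (T2RecOf 3 Lc (fun j => KInvStep (d := 3) Lc j) (SpureRecAt 3 Lc (toSite r) cE cVH cΛ) (M1At 3 Lc (toSite r) cΛ) cE₂ cB Tc vh₂S (mixFFAt (toSite r) Lc) m)))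
    (fun m => (((lin4 (cE₂ * (Lc : ℝ) ^ (2 * (3 + 1))) (unitK (sfStep Lc m) (smStep 3 Lc m) (coDressKBmAt (toSite r) Lc (KInvStep (d := 3) Lc m))) Lc
            (unitS₂ (sfStep Lc m) (smStep 3 Lc m) (T2RecAt 3 Lc (toSite r) cE cVH cΛ cE₂ cB Tc vh₂S (mixFFAt (toSite r) Lc) m)) -
          lin4 (cE₂ * (Lc : ℝ) ^ (2 * (3 + 1))) (unitK (sfStep Lc m) (smStep 3 Lc m) (KInvStep (d := 3) Lc m)) Lc
            (unitS₂ (sfStep Lc m) (smStep 3 Lc m) (T2RecAt 3 Lc (toSite r) cE cVH cΛ cE₂ cB Tc vh₂S (mixFFAt (toSite r) Lc) m))) +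
        ((fun κ u κ' u' => (cE₂ * (Lc : ℝ) ^ (2 * (3 + 1))) • mmRead Lc (K3OfK (unitK (sfStep Lc m) (smStep 3 Lc m) (coDressKBmAt (toSite r) Lc (KInvStep (d := 3) Lc m))) Lc
            (unitS (sfStep Lc m) (smStep 3 Lc m) (SpureRecAt 3 Lc (toSite r) cE cVH cΛ m)) (unitM (sfStep Lc m) (smStep 3 Lc m) (M1At 3 Lc (toSite r) cΛ m))
            (W2SymOfK (unitK (sfStep Lc m) (smStep 3 Lc m) (coDressKBmAt (toSite r) Lc (KInvStep (d := 3) Lc m))) Lc (unitS (sfStep Lc m) (smStep 3 Lc m) (SpureRecAt 3 Lc (toSite r) cE cVH cΛ m))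
              (unitM (sfStep Lc m) (smStep 3 Lc m) (M1At 3 Lc (toSite r) cΛ m)) 0 (unitM₂ (sfStep Lc m) (smStep 3 Lc m) (M2Of 3 Lc (mixFFAt (toSite r) Lc) m))) κ u κ' u')
          + cB • vh₂S κ u κ' u') -
         (fun κ u κ' u' => (cE₂ * (Lc : ℝ) ^ (2 * (3 + 1))) • mmRead Lc (K3OfK (unitK (sfStep Lc m) (smStep 3 Lc m) (KInvStep (d := 3) Lc m)) Lc
            (unitS (sfStep Lc m) (smStep 3 Lc m) (SpureRecAt 3 Lc (toSite r) cE cVH cΛ m)) (unitM (sfStep Lc m) (smStep 3 Lc m) (M1At 3 Lc (toSite r) cΛ m))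
            (W2SymOfK (unitK (sfStep Lc m) (smStep 3 Lc m) (KInvStep (d := 3) Lc m)) Lc (unitS (sfStep Lc m) (smStep 3 Lc m) (SpureRecAt 3 Lc (toSite r) cE cVH cΛ m))
              (unitM (sfStep Lc m) (smStep 3 Lc m) (M1At 3 Lc (toSite r) cΛ m)) 0 (unitM₂ (sfStep Lc m) (smStep 3 Lc m) (M2Of 3 Lc (mixFFAt (toSite r) Lc) m))) κ u κ' u')
          + cB • vh₂S κ u κ' u')))))
    hK hKall hδK hθK0 hθK1 hD hδD hHr hθh0 hθh1 hδh'
  have hδin : 0 < min δf δh := lt_min hδf hδh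
  obtain ⟨CT, CT', δT, -, hCT', hδT, -, -, hirr⟩ := transport_rows_three_symZ hLc1 hK hδK cE₂ hδin (fun _ => (0 : ℝ))
  -- the `ZfreeSym` text of every `h_m` from (C)
  have hZh := fun m : ℕ => zfreeSym_h_of_conservedSym hLc1 hr cE cVH cΛ cE₂ cB Tc hBff hBmm hB hBt m (fun i _ κ κ' κ₁ κ₂ => hC i κ κ' κ₁ κ₂)
  exact drift_of_dev_rows (d := 3)
    (fun m => (unitS₂ (sfStep Lc m) (smStep 3 Lc m) (T2RecOf 3 Lc (fun j => KInvStep (d := 3) Lc j) (SpureRecAt 3 Lc (toSite r) cE cVH cΛ) (M1At 3 Lc (toSite r) cΛ) cE₂ cB Tc vh₂S (mixFFAt (toSite r) Lc) m)))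
    (fun m => (unitS₂ (sfStep Lc m) (smStep 3 Lc m) (T2RecAt 3 Lc (toSite r) cE cVH cΛ cE₂ cB Tc vh₂S (mixFFAt (toSite r) Lc) m)))
    (fun m => (((lin4 (cE₂ * (Lc : ℝ) ^ (2 * (3 + 1))) (unitK (sfStep Lc m) (smStep 3 Lc m) (coDressKBmAt (toSite r) Lc (KInvStep (d := 3) Lc m))) Lc
            (unitS₂ (sfStep Lc m) (smStep 3 Lc m) (T2RecAt 3 Lc (toSite r) cE cVH cΛ cE₂ cB Tc vh₂S (mixFFAt (toSite r) Lc) m)) -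
          lin4 (cE₂ * (Lc : ℝ) ^ (2 * (3 + 1))) (unitK (sfStep Lc m) (smStep 3 Lc m) (KInvStep (d := 3) Lc m)) Lc
            (unitS₂ (sfStep Lc m) (smStep 3 Lc m) (T2RecAt 3 Lc (toSite r) cE cVH cΛ cE₂ cB Tc vh₂S (mixFFAt (toSite r) Lc) m))) +
        ((fun κ u κ' u' => (cE₂ * (Lc : ℝ) ^ (2 * (3 + 1))) • mmRead Lc (K3OfK (unitK (sfStep Lc m) (smStep 3 Lc m) (coDressKBmAt (toSite r) Lc (KInvStep (d := 3) Lc m))) Lc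
            (unitS (sfStep Lc m) (smStep 3 Lc m) (SpureRecAt 3 Lc (toSite r) cE cVH cΛ m)) (unitM (sfStep Lc m) (smStep 3 Lc m) (M1At 3 Lc (toSite r) cΛ m))
            (W2SymOfK (unitK (sfStep Lc m) (smStep 3 Lc m) (coDressKBmAt (toSite r) Lc (KInvStep (d := 3) Lc m))) Lc (unitS (sfStep Lc m) (smStep 3 Lc m) (SpureRecAt 3 Lc (toSite r) cE cVH cΛ m))
              (unitM (sfStep Lc m) (smStep 3 Lc m) (M1At 3 Lc (toSite r) cΛ m)) 0 (unitM₂ (sfStep Lc m) (smStep 3 Lc m) (M2Of 3 Lc (mixFFAt (toSite r) Lc) m))) κ u κ' u')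
          + cB • vh₂S κ u κ' u') -
         (fun κ u κ' u' => (cE₂ * (Lc : ℝ) ^ (2 * (3 + 1))) • mmRead Lc (K3OfK (unitK (sfStep Lc m) (smStep 3 Lc m) (KInvStep (d := 3) Lc m)) Lc
            (unitS (sfStep Lc m) (smStep 3 Lc m) (SpureRecAt 3 Lc (toSite r) cE cVH cΛ m)) (unitM (sfStep Lc m) (smStep 3 Lc m) (M1At 3 Lc (toSite r) cΛ m))
            (W2SymOfK (unitK (sfStep Lc m) (smStep 3 Lc m) (KInvStep (d := 3) Lc m)) Lc (unitS (sfStep Lc m) (smStep 3 Lc m) (SpureRecAt 3 Lc (toSite r) cE cVH cΛ m))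
              (unitM (sfStep Lc m) (smStep 3 Lc m) (M1At 3 Lc (toSite r) cΛ m)) 0 (unitM₂ (sfStep Lc m) (smStep 3 Lc m) (M2Of 3 Lc (mixFFAt (toSite r) Lc) m))) κ u κ' u')
          + cB • vh₂S κ u κ' u')))))
    (fun j => lin4 (cE₂ * (Lc : ℝ) ^ (2 * (3 + 1))) (unitK (sfStep Lc j) (smStep 3 Lc j) (KInvStep (d := 3) Lc j)) Lc)
    (fun X => (∀ κ u κ' u' t, X κ (u + (Lc : ℤ) • t) κ' (u' + (Lc : ℤ) • t) = shiftK (-((Lc : ℤ) • t)) (X κ u κ' u')) ∧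
      (∀ κ κ' κ₁ κ₂, zmode Lc X κ κ' (Sum.inl κ₁) (Sum.inl κ₂) + zmode Lc X κ' κ (Sum.inl κ₁) (Sum.inl κ₂) = 0))
    (fun _ => (0 : ℝ)) (lin4_bdd₄ cE₂) (lin4_add_bdd₄ cE₂)
    (fun j => devB_comb_succ hLc1 hr cE cVH cΛ cE₂ cB Tc hBff hBmm hB j)
    (sub_eq_zero.mp (dev_comb_zero (d := 3) (Lc := Lc) (r := r) cE cVH cΛ cE₂ cB Tc (vh₂S := vh₂S)))
    hU hδ₂.le hT' hδ₂'.le hH hδh.le hUd hcU hϑU0 hϑU1 hδU hCT' inv_natCast_nonneg (inv_natCast_lt_one hLc) hθf0 hθf1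
    (fun m => ⟨(hf m).mono (min_le_left _ _), mul_nonneg hCf (pow_nonneg hθf0 m)⟩)
    (fun m => zfreeSym_forcing (d := 3) hLc1 (m + 1) m (cE₂ * (Lc : ℝ) ^ (2 * (3 + 1))) (hK (m + 1)) (hK m) hCK hδK (hD m) hδD (hDcov m)
      (hH m) (hH (m + 1)) hδh (hZh m) (hZh (m + 1)))
    ⟨(hH 0).mono (min_le_right _ _), (hH 0).nonneg⟩ (hZh 0) (hirr hpin) hδT

/-! ## §3 The JOINT PAIR («T2Shape», «T2Drift») at one rate, and (hW, hWall) of the comb family by p2's `WrecAtSlotRowsFinal` -/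

/-- NOT IN PRINT; OUR PROOF ATTEMPT ([folklore] `T2DevConservationEnd.t2Shape_T2RecAt_three_of_U_C_H` ∧ §2, `min` of the two rates, `WSlotT2OfPieces.cauchy_of_rate`).  **THE TWO T₂
ROWS OF p2's `WrecAtSlotRowsFinal.hW_hWall_WrecAt_three_of_T2` FOR THE COMB FAMILY, AT ONE RATE, FROM (U) ∧ (U-drift) ∧ (C) ∧ (H) ∧ (H-rate)**:
`∃ C₂ c₂ θ₂ δ₂, 0 < δ₂ ∧ 0 ≤ θ₂ ∧ θ₂ < 1 ∧ (∀ j, LocStencil₂ (T̃_j) C₂ δ₂) ∧ (∀ k j, LocStencil₂ (T̃_{k+j} − T̃_k) (c₂·θ₂^k) δ₂)` — the binders `hT₂`, `hT₂d` token for token.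
CONDITIONAL on the five rows; NEVER «G-an2-4 closed» as (CONV-C); NOT D1, NOT `BetaPertH`, NOT continuum, NOT Clay. -/
theorem exists_hT₂_hT₂d_T2RecAt_three_of_rows (hLc : 2 ≤ Lc) (hr : r ∈ box (3 + 1) Lc) (cE cVH cΛ cE₂ cB : ℝ) (Tc : Fin 4 → Fin 4 → Fin 4 → Fin 4 → ℝ)
    {vh₂S : Tab 3}
    (hBff : ∀ κ u κ' u' x z (α β : Fin (3 + 1)), vh₂S κ u κ' u' x z (Sum.inl α) (Sum.inl β) = 0)
    (hBmm : ∀ κ u κ' u' x z (μ ν : Fin (3 + 1)), vh₂S κ u κ' u' x z (Sum.inr μ) (Sum.inr ν) = 0)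
    (hB : ∃ C δ : ℝ, 0 < δ ∧ LocStencil₂ vh₂S C δ)
    (hBt : ∀ (κ : Fin (3 + 1)) (u : Fin (3 + 1) → ℤ) (κ' : Fin (3 + 1)) (u' t : Fin (3 + 1) → ℤ),
      vh₂S κ (u + (Lc : ℤ) • t) κ' (u' + (Lc : ℤ) • t) = shiftK (-((Lc : ℤ) • t)) (vh₂S κ u κ' u'))
    (hpin : |cE₂| ≤ (Lc : ℝ) ^ (2 * (3 + 1))) {C₂ δ₂ Ch δh cU ϑU δU Ch' θh δh' : ℝ} (hδ₂ : 0 < δ₂) (hδh : 0 < δh)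
    (hU : ∀ n : ℕ, LocStencil₂ (unitS₂ (sfStep Lc n) (smStep 3 Lc n) (T2RecOf 3 Lc (fun j => KInvStep (d := 3) Lc j) (SpureRecAt 3 Lc (toSite r) cE cVH cΛ) (M1At 3 Lc (toSite r) cΛ) cE₂ cB Tc vh₂S (mixFFAt (toSite r) Lc) n)) C₂ δ₂)
    (hUd : ∀ n : ℕ, LocStencil₂ ((unitS₂ (sfStep Lc (n + 1)) (smStep 3 Lc (n + 1)) (T2RecOf 3 Lc (fun j => KInvStep (d := 3) Lc j) (SpureRecAt 3 Lc (toSite r) cE cVH cΛ) (M1At 3 Lc (toSite r) cΛ) cE₂ cB Tc vh₂S (mixFFAt (toSite r) Lc) (n + 1))) - (unitS₂ (sfStep Lc n) (smStep 3 Lc n) (T2RecOf 3 Lc (fun j => KInvStep (d := 3) Lc j) (SpureRecAt 3 Lc (toSite r) cE cVH cΛ) (M1At 3 Lc (toSite r) cΛ) cE₂ cB Tc vh₂S (mixFFAt (toSite r) Lc) n))) (cU * ϑU ^ n) δU)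
    (hcU : 0 ≤ cU) (hϑU0 : 0 ≤ ϑU) (hϑU1 : ϑU < 1) (hδU : 0 < δU)
    (hC : ∀ (i : ℕ) (κ κ' κ₁ κ₂ : Fin (3 + 1)),
      zmode Lc (unitS₂ (sfStep Lc i) (smStep 3 Lc i) (T2RecAt 3 Lc (toSite r) cE cVH cΛ cE₂ cB Tc vh₂S (mixFFAt (toSite r) Lc) i)) κ κ' (Sum.inl κ₁) (Sum.inl κ₂)
          + zmode Lc (unitS₂ (sfStep Lc i) (smStep 3 Lc i) (T2RecAt 3 Lc (toSite r) cE cVH cΛ cE₂ cB Tc vh₂S (mixFFAt (toSite r) Lc) i)) κ' κ (Sum.inl κ₁) (Sum.inl κ₂)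
        = zmode Lc (unitS₂ (sfStep Lc i) (smStep 3 Lc i) (T2RecOf 3 Lc (fun j => KInvStep (d := 3) Lc j) (SpureRecAt 3 Lc (toSite r) cE cVH cΛ) (M1At 3 Lc (toSite r) cΛ) cE₂ cB Tc vh₂S (mixFFAt (toSite r) Lc) i)) κ κ' (Sum.inl κ₁) (Sum.inl κ₂)
          + zmode Lc (unitS₂ (sfStep Lc i) (smStep 3 Lc i) (T2RecOf 3 Lc (fun j => KInvStep (d := 3) Lc j) (SpureRecAt 3 Lc (toSite r) cE cVH cΛ) (M1At 3 Lc (toSite r) cΛ) cE₂ cB Tc vh₂S (mixFFAt (toSite r) Lc) i)) κ' κ (Sum.inl κ₁) (Sum.inl κ₂))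
    (hH : ∀ m : ℕ, LocStencil₂ (((lin4 (cE₂ * (Lc : ℝ) ^ (2 * (3 + 1))) (unitK (sfStep Lc m) (smStep 3 Lc m) (coDressKBmAt (toSite r) Lc (KInvStep (d := 3) Lc m))) Lc
            (unitS₂ (sfStep Lc m) (smStep 3 Lc m) (T2RecAt 3 Lc (toSite r) cE cVH cΛ cE₂ cB Tc vh₂S (mixFFAt (toSite r) Lc) m)) -
          lin4 (cE₂ * (Lc : ℝ) ^ (2 * (3 + 1))) (unitK (sfStep Lc m) (smStep 3 Lc m) (KInvStep (d := 3) Lc m)) Lc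
            (unitS₂ (sfStep Lc m) (smStep 3 Lc m) (T2RecAt 3 Lc (toSite r) cE cVH cΛ cE₂ cB Tc vh₂S (mixFFAt (toSite r) Lc) m))) +
        ((fun κ u κ' u' => (cE₂ * (Lc : ℝ) ^ (2 * (3 + 1))) • mmRead Lc (K3OfK (unitK (sfStep Lc m) (smStep 3 Lc m) (coDressKBmAt (toSite r) Lc (KInvStep (d := 3) Lc m))) Lc
            (unitS (sfStep Lc m) (smStep 3 Lc m) (SpureRecAt 3 Lc (toSite r) cE cVH cΛ m)) (unitM (sfStep Lc m) (smStep 3 Lc m) (M1At 3 Lc (toSite r) cΛ m))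
            (W2SymOfK (unitK (sfStep Lc m) (smStep 3 Lc m) (coDressKBmAt (toSite r) Lc (KInvStep (d := 3) Lc m))) Lc (unitS (sfStep Lc m) (smStep 3 Lc m) (SpureRecAt 3 Lc (toSite r) cE cVH cΛ m))
              (unitM (sfStep Lc m) (smStep 3 Lc m) (M1At 3 Lc (toSite r) cΛ m)) 0 (unitM₂ (sfStep Lc m) (smStep 3 Lc m) (M2Of 3 Lc (mixFFAt (toSite r) Lc) m))) κ u κ' u')
          + cB • vh₂S κ u κ' u') -
         (fun κ u κ' u' => (cE₂ * (Lc : ℝ) ^ (2 * (3 + 1))) • mmRead Lc (K3OfK (unitK (sfStep Lc m) (smStep 3 Lc m) (KInvStep (d := 3) Lc m)) Lc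
            (unitS (sfStep Lc m) (smStep 3 Lc m) (SpureRecAt 3 Lc (toSite r) cE cVH cΛ m)) (unitM (sfStep Lc m) (smStep 3 Lc m) (M1At 3 Lc (toSite r) cΛ m))
            (W2SymOfK (unitK (sfStep Lc m) (smStep 3 Lc m) (KInvStep (d := 3) Lc m)) Lc (unitS (sfStep Lc m) (smStep 3 Lc m) (SpureRecAt 3 Lc (toSite r) cE cVH cΛ m))
              (unitM (sfStep Lc m) (smStep 3 Lc m) (M1At 3 Lc (toSite r) cΛ m)) 0 (unitM₂ (sfStep Lc m) (smStep 3 Lc m) (M2Of 3 Lc (mixFFAt (toSite r) Lc) m))) κ u κ' u')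
          + cB • vh₂S κ u κ' u')))) Ch δh)
    (hHr : ∀ m : ℕ, LocStencil₂ ((((lin4 (cE₂ * (Lc : ℝ) ^ (2 * (3 + 1))) (unitK (sfStep Lc (m + 1)) (smStep 3 Lc (m + 1)) (coDressKBmAt (toSite r) Lc (KInvStep (d := 3) Lc (m + 1)))) Lc
            (unitS₂ (sfStep Lc (m + 1)) (smStep 3 Lc (m + 1)) (T2RecAt 3 Lc (toSite r) cE cVH cΛ cE₂ cB Tc vh₂S (mixFFAt (toSite r) Lc) (m + 1))) -
          lin4 (cE₂ * (Lc : ℝ) ^ (2 * (3 + 1))) (unitK (sfStep Lc (m + 1)) (smStep 3 Lc (m + 1)) (KInvStep (d := 3) Lc (m + 1))) Lc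
            (unitS₂ (sfStep Lc (m + 1)) (smStep 3 Lc (m + 1)) (T2RecAt 3 Lc (toSite r) cE cVH cΛ cE₂ cB Tc vh₂S (mixFFAt (toSite r) Lc) (m + 1)))) +
        ((fun κ u κ' u' => (cE₂ * (Lc : ℝ) ^ (2 * (3 + 1))) • mmRead Lc (K3OfK (unitK (sfStep Lc (m + 1)) (smStep 3 Lc (m + 1)) (coDressKBmAt (toSite r) Lc (KInvStep (d := 3) Lc (m + 1)))) Lc
            (unitS (sfStep Lc (m + 1)) (smStep 3 Lc (m + 1)) (SpureRecAt 3 Lc (toSite r) cE cVH cΛ (m + 1))) (unitM (sfStep Lc (m + 1)) (smStep 3 Lc (m + 1)) (M1At 3 Lc (toSite r) cΛ (m + 1)))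
            (W2SymOfK (unitK (sfStep Lc (m + 1)) (smStep 3 Lc (m + 1)) (coDressKBmAt (toSite r) Lc (KInvStep (d := 3) Lc (m + 1)))) Lc (unitS (sfStep Lc (m + 1)) (smStep 3 Lc (m + 1)) (SpureRecAt 3 Lc (toSite r) cE cVH cΛ (m + 1)))
              (unitM (sfStep Lc (m + 1)) (smStep 3 Lc (m + 1)) (M1At 3 Lc (toSite r) cΛ (m + 1))) 0 (unitM₂ (sfStep Lc (m + 1)) (smStep 3 Lc (m + 1)) (M2Of 3 Lc (mixFFAt (toSite r) Lc) (m + 1)))) κ u κ' u')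
          + cB • vh₂S κ u κ' u') -
         (fun κ u κ' u' => (cE₂ * (Lc : ℝ) ^ (2 * (3 + 1))) • mmRead Lc (K3OfK (unitK (sfStep Lc (m + 1)) (smStep 3 Lc (m + 1)) (KInvStep (d := 3) Lc (m + 1))) Lc
            (unitS (sfStep Lc (m + 1)) (smStep 3 Lc (m + 1)) (SpureRecAt 3 Lc (toSite r) cE cVH cΛ (m + 1))) (unitM (sfStep Lc (m + 1)) (smStep 3 Lc (m + 1)) (M1At 3 Lc (toSite r) cΛ (m + 1)))
            (W2SymOfK (unitK (sfStep Lc (m + 1)) (smStep 3 Lc (m + 1)) (KInvStep (d := 3) Lc (m + 1))) Lc (unitS (sfStep Lc (m + 1)) (smStep 3 Lc (m + 1)) (SpureRecAt 3 Lc (toSite r) cE cVH cΛ (m + 1)))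
              (unitM (sfStep Lc (m + 1)) (smStep 3 Lc (m + 1)) (M1At 3 Lc (toSite r) cΛ (m + 1))) 0 (unitM₂ (sfStep Lc (m + 1)) (smStep 3 Lc (m + 1)) (M2Of 3 Lc (mixFFAt (toSite r) Lc) (m + 1)))) κ u κ' u')
          + cB • vh₂S κ u κ' u')))) -
      (((lin4 (cE₂ * (Lc : ℝ) ^ (2 * (3 + 1))) (unitK (sfStep Lc m) (smStep 3 Lc m) (coDressKBmAt (toSite r) Lc (KInvStep (d := 3) Lc m))) Lc
            (unitS₂ (sfStep Lc m) (smStep 3 Lc m) (T2RecAt 3 Lc (toSite r) cE cVH cΛ cE₂ cB Tc vh₂S (mixFFAt (toSite r) Lc) m)) -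
          lin4 (cE₂ * (Lc : ℝ) ^ (2 * (3 + 1))) (unitK (sfStep Lc m) (smStep 3 Lc m) (KInvStep (d := 3) Lc m)) Lc
            (unitS₂ (sfStep Lc m) (smStep 3 Lc m) (T2RecAt 3 Lc (toSite r) cE cVH cΛ cE₂ cB Tc vh₂S (mixFFAt (toSite r) Lc) m))) +
        ((fun κ u κ' u' => (cE₂ * (Lc : ℝ) ^ (2 * (3 + 1))) • mmRead Lc (K3OfK (unitK (sfStep Lc m) (smStep 3 Lc m) (coDressKBmAt (toSite r) Lc (KInvStep (d := 3) Lc m))) Lc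
            (unitS (sfStep Lc m) (smStep 3 Lc m) (SpureRecAt 3 Lc (toSite r) cE cVH cΛ m)) (unitM (sfStep Lc m) (smStep 3 Lc m) (M1At 3 Lc (toSite r) cΛ m))
            (W2SymOfK (unitK (sfStep Lc m) (smStep 3 Lc m) (coDressKBmAt (toSite r) Lc (KInvStep (d := 3) Lc m))) Lc (unitS (sfStep Lc m) (smStep 3 Lc m) (SpureRecAt 3 Lc (toSite r) cE cVH cΛ m))
              (unitM (sfStep Lc m) (smStep 3 Lc m) (M1At 3 Lc (toSite r) cΛ m)) 0 (unitM₂ (sfStep Lc m) (smStep 3 Lc m) (M2Of 3 Lc (mixFFAt (toSite r) Lc) m))) κ u κ' u')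
          + cB • vh₂S κ u κ' u') -
         (fun κ u κ' u' => (cE₂ * (Lc : ℝ) ^ (2 * (3 + 1))) • mmRead Lc (K3OfK (unitK (sfStep Lc m) (smStep 3 Lc m) (KInvStep (d := 3) Lc m)) Lc
            (unitS (sfStep Lc m) (smStep 3 Lc m) (SpureRecAt 3 Lc (toSite r) cE cVH cΛ m)) (unitM (sfStep Lc m) (smStep 3 Lc m) (M1At 3 Lc (toSite r) cΛ m))
            (W2SymOfK (unitK (sfStep Lc m) (smStep 3 Lc m) (KInvStep (d := 3) Lc m)) Lc (unitS (sfStep Lc m) (smStep 3 Lc m) (SpureRecAt 3 Lc (toSite r) cE cVH cΛ m))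
              (unitM (sfStep Lc m) (smStep 3 Lc m) (M1At 3 Lc (toSite r) cΛ m)) 0 (unitM₂ (sfStep Lc m) (smStep 3 Lc m) (M2Of 3 Lc (mixFFAt (toSite r) Lc) m))) κ u κ' u')
          + cB • vh₂S κ u κ' u'))))) (Ch' * θh ^ m) δh')
    (hθh0 : 0 ≤ θh) (hθh1 : θh < 1) (hδh' : 0 < δh') :
    ∃ C₂ c₂ θ₂ δ₂ : ℝ, 0 < δ₂ ∧ 0 ≤ θ₂ ∧ θ₂ < 1 ∧
      (∀ j : ℕ, LocStencil₂ (unitS₂ (sfStep Lc j) (smStep 3 Lc j) (T2RecAt 3 Lc (toSite r) cE cVH cΛ cE₂ cB Tc vh₂S (mixFFAt (toSite r) Lc) j)) C₂ δ₂) ∧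
      (∀ k j : ℕ, LocStencil₂ ((unitS₂ (sfStep Lc (k + j)) (smStep 3 Lc (k + j)) (T2RecAt 3 Lc (toSite r) cE cVH cΛ cE₂ cB Tc vh₂S (mixFFAt (toSite r) Lc) (k + j))) -
        (unitS₂ (sfStep Lc k) (smStep 3 Lc k) (T2RecAt 3 Lc (toSite r) cE cVH cΛ cE₂ cB Tc vh₂S (mixFFAt (toSite r) Lc) k))) (c₂ * θ₂ ^ k) δ₂) := by
  obtain ⟨C, δ, hδ, hT⟩ := t2Shape_T2RecAt_three_of_U_C_H hLc hr cE cVH cΛ cE₂ cB Tc hBff hBmm hB hBt hpin hδ₂ hδh hU hC hH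
  obtain ⟨c, ϑ, δ', hc, hϑ0, hϑ1, hδ', hD⟩ := t2Drift_T2RecAt_three_of_U_Ud_C_H_Hr hLc hr cE cVH cΛ cE₂ cB Tc hBff hBmm hB hBt hpin hδ₂ hδh hU hUd hcU hϑU0 hϑU1
    hδU hC hH hHr hθh0 hθh1 hδh'
  refine ⟨C, c * (1 - ϑ)⁻¹, ϑ, min δ δ', lt_min hδ hδ', hϑ0.le, hϑ1, fun j => (hT j).mono (min_le_left _ _), fun k j => ?_⟩
  exact cauchy_of_rate (fun n => (unitS₂ (sfStep Lc n) (smStep 3 Lc n) (T2RecAt 3 Lc (toSite r) cE cVH cΛ cE₂ cB Tc vh₂S (mixFFAt (toSite r) Lc) n))) hc hϑ0.le hϑ1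
    (fun n => (hD n).mono (min_le_right _ _)) k j

/-- NOT IN PRINT; OUR PROOF ATTEMPT ([folklore] `exists_hT₂_hT₂d_T2RecAt_three_of_rows` ∘ p2's `WrecAtSlotRowsFinal.hW_hWall_WrecAt_three_of_T2`, junction by `exact`).  **THE TWO W-SLOT
ROWS (hW, hWall) OF THE `d = 3` COMB FAMILY FROM THE FIVE ROWS** (`2 ≤ Lc`, pin `cE = Lc^{3+1}`, every in-block root, every `cVH cΛ cB Tc`, the pin `|cE₂| ≤ Lc^8`, every jointly
covariant off-diagonal `LocStencil₂` border): (U) ∧ (U-drift) ∧ (C) ∧ (H) ∧ (H-rate) ⟹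
`∃ Cw cW θW δW, 0 ≤ θW ∧ θW < 1 ∧ 0 < δW ∧ (∀ j, VertexFamily₂ (unitW_j (WrecAt … j)) Lc Cw δW) ∧ (∀ k j, VertexFamily₂ (unitW_{k+j} (WrecAt … (k+j)) − unitW_k (WrecAt … k)) Lc (cW·θW^k) δW)`.
The S-slot rows, the dressed K-rows, the multiplier ∕ mixed tables are TREE theorems inside p2's theorem (OWNER, asym1 ∘ road P1, an2, an1); the five T₂-side rows are DISPLAYED.
CONDITIONAL; NOT «W-slot closed»; NEVER «G-an2-4 closed» as (CONV-C); NOT D1, NOT `BetaPertH`, NOT continuum, NOT Clay. -/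
theorem hW_hWall_WrecAt_three_of_rows (hLc : 2 ≤ Lc) {cE : ℝ} (hcE : cE = (Lc : ℝ) ^ (3 + 1)) (hr : r ∈ box (3 + 1) Lc) (cVH cΛ cE₂ cB : ℝ)
    (Tc : Fin 4 → Fin 4 → Fin 4 → Fin 4 → ℝ)
    {vh₂S : Tab 3}
    (hBff : ∀ κ u κ' u' x z (α β : Fin (3 + 1)), vh₂S κ u κ' u' x z (Sum.inl α) (Sum.inl β) = 0)
    (hBmm : ∀ κ u κ' u' x z (μ ν : Fin (3 + 1)), vh₂S κ u κ' u' x z (Sum.inr μ) (Sum.inr ν) = 0)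
    (hB : ∃ C δ : ℝ, 0 < δ ∧ LocStencil₂ vh₂S C δ)
    (hBt : ∀ (κ : Fin (3 + 1)) (u : Fin (3 + 1) → ℤ) (κ' : Fin (3 + 1)) (u' t : Fin (3 + 1) → ℤ),
      vh₂S κ (u + (Lc : ℤ) • t) κ' (u' + (Lc : ℤ) • t) = shiftK (-((Lc : ℤ) • t)) (vh₂S κ u κ' u'))
    (hpin : |cE₂| ≤ (Lc : ℝ) ^ (2 * (3 + 1))) {C₂ δ₂ Ch δh cU ϑU δU Ch' θh δh' : ℝ} (hδ₂ : 0 < δ₂) (hδh : 0 < δh)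
    (hU : ∀ n : ℕ, LocStencil₂ (unitS₂ (sfStep Lc n) (smStep 3 Lc n) (T2RecOf 3 Lc (fun j => KInvStep (d := 3) Lc j) (SpureRecAt 3 Lc (toSite r) cE cVH cΛ) (M1At 3 Lc (toSite r) cΛ) cE₂ cB Tc vh₂S (mixFFAt (toSite r) Lc) n)) C₂ δ₂)
    (hUd : ∀ n : ℕ, LocStencil₂ ((unitS₂ (sfStep Lc (n + 1)) (smStep 3 Lc (n + 1)) (T2RecOf 3 Lc (fun j => KInvStep (d := 3) Lc j) (SpureRecAt 3 Lc (toSite r) cE cVH cΛ) (M1At 3 Lc (toSite r) cΛ) cE₂ cB Tc vh₂S (mixFFAt (toSite r) Lc) (n + 1))) - (unitS₂ (sfStep Lc n) (smStep 3 Lc n) (T2RecOf 3 Lc (fun j => KInvStep (d := 3) Lc j) (SpureRecAt 3 Lc (toSite r) cE cVH cΛ) (M1At 3 Lc (toSite r) cΛ) cE₂ cB Tc vh₂S (mixFFAt (toSite r) Lc) n))) (cU * ϑU ^ n) δU)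
    (hcU : 0 ≤ cU) (hϑU0 : 0 ≤ ϑU) (hϑU1 : ϑU < 1) (hδU : 0 < δU)
    (hC : ∀ (i : ℕ) (κ κ' κ₁ κ₂ : Fin (3 + 1)),
      zmode Lc (unitS₂ (sfStep Lc i) (smStep 3 Lc i) (T2RecAt 3 Lc (toSite r) cE cVH cΛ cE₂ cB Tc vh₂S (mixFFAt (toSite r) Lc) i)) κ κ' (Sum.inl κ₁) (Sum.inl κ₂)
          + zmode Lc (unitS₂ (sfStep Lc i) (smStep 3 Lc i) (T2RecAt 3 Lc (toSite r) cE cVH cΛ cE₂ cB Tc vh₂S (mixFFAt (toSite r) Lc) i)) κ' κ (Sum.inl κ₁) (Sum.inl κ₂)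
        = zmode Lc (unitS₂ (sfStep Lc i) (smStep 3 Lc i) (T2RecOf 3 Lc (fun j => KInvStep (d := 3) Lc j) (SpureRecAt 3 Lc (toSite r) cE cVH cΛ) (M1At 3 Lc (toSite r) cΛ) cE₂ cB Tc vh₂S (mixFFAt (toSite r) Lc) i)) κ κ' (Sum.inl κ₁) (Sum.inl κ₂)
          + zmode Lc (unitS₂ (sfStep Lc i) (smStep 3 Lc i) (T2RecOf 3 Lc (fun j => KInvStep (d := 3) Lc j) (SpureRecAt 3 Lc (toSite r) cE cVH cΛ) (M1At 3 Lc (toSite r) cΛ) cE₂ cB Tc vh₂S (mixFFAt (toSite r) Lc) i)) κ' κ (Sum.inl κ₁) (Sum.inl κ₂))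
    (hH : ∀ m : ℕ, LocStencil₂ (((lin4 (cE₂ * (Lc : ℝ) ^ (2 * (3 + 1))) (unitK (sfStep Lc m) (smStep 3 Lc m) (coDressKBmAt (toSite r) Lc (KInvStep (d := 3) Lc m))) Lc
            (unitS₂ (sfStep Lc m) (smStep 3 Lc m) (T2RecAt 3 Lc (toSite r) cE cVH cΛ cE₂ cB Tc vh₂S (mixFFAt (toSite r) Lc) m)) -
          lin4 (cE₂ * (Lc : ℝ) ^ (2 * (3 + 1))) (unitK (sfStep Lc m) (smStep 3 Lc m) (KInvStep (d := 3) Lc m)) Lc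
            (unitS₂ (sfStep Lc m) (smStep 3 Lc m) (T2RecAt 3 Lc (toSite r) cE cVH cΛ cE₂ cB Tc vh₂S (mixFFAt (toSite r) Lc) m))) +
        ((fun κ u κ' u' => (cE₂ * (Lc : ℝ) ^ (2 * (3 + 1))) • mmRead Lc (K3OfK (unitK (sfStep Lc m) (smStep 3 Lc m) (coDressKBmAt (toSite r) Lc (KInvStep (d := 3) Lc m))) Lc
            (unitS (sfStep Lc m) (smStep 3 Lc m) (SpureRecAt 3 Lc (toSite r) cE cVH cΛ m)) (unitM (sfStep Lc m) (smStep 3 Lc m) (M1At 3 Lc (toSite r) cΛ m))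
            (W2SymOfK (unitK (sfStep Lc m) (smStep 3 Lc m) (coDressKBmAt (toSite r) Lc (KInvStep (d := 3) Lc m))) Lc (unitS (sfStep Lc m) (smStep 3 Lc m) (SpureRecAt 3 Lc (toSite r) cE cVH cΛ m))
              (unitM (sfStep Lc m) (smStep 3 Lc m) (M1At 3 Lc (toSite r) cΛ m)) 0 (unitM₂ (sfStep Lc m) (smStep 3 Lc m) (M2Of 3 Lc (mixFFAt (toSite r) Lc) m))) κ u κ' u')
          + cB • vh₂S κ u κ' u') -
         (fun κ u κ' u' => (cE₂ * (Lc : ℝ) ^ (2 * (3 + 1))) • mmRead Lc (K3OfK (unitK (sfStep Lc m) (smStep 3 Lc m) (KInvStep (d := 3) Lc m)) Lc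
            (unitS (sfStep Lc m) (smStep 3 Lc m) (SpureRecAt 3 Lc (toSite r) cE cVH cΛ m)) (unitM (sfStep Lc m) (smStep 3 Lc m) (M1At 3 Lc (toSite r) cΛ m))
            (W2SymOfK (unitK (sfStep Lc m) (smStep 3 Lc m) (KInvStep (d := 3) Lc m)) Lc (unitS (sfStep Lc m) (smStep 3 Lc m) (SpureRecAt 3 Lc (toSite r) cE cVH cΛ m))
              (unitM (sfStep Lc m) (smStep 3 Lc m) (M1At 3 Lc (toSite r) cΛ m)) 0 (unitM₂ (sfStep Lc m) (smStep 3 Lc m) (M2Of 3 Lc (mixFFAt (toSite r) Lc) m))) κ u κ' u')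
          + cB • vh₂S κ u κ' u')))) Ch δh)
    (hHr : ∀ m : ℕ, LocStencil₂ ((((lin4 (cE₂ * (Lc : ℝ) ^ (2 * (3 + 1))) (unitK (sfStep Lc (m + 1)) (smStep 3 Lc (m + 1)) (coDressKBmAt (toSite r) Lc (KInvStep (d := 3) Lc (m + 1)))) Lc
            (unitS₂ (sfStep Lc (m + 1)) (smStep 3 Lc (m + 1)) (T2RecAt 3 Lc (toSite r) cE cVH cΛ cE₂ cB Tc vh₂S (mixFFAt (toSite r) Lc) (m + 1))) -
          lin4 (cE₂ * (Lc : ℝ) ^ (2 * (3 + 1))) (unitK (sfStep Lc (m + 1)) (smStep 3 Lc (m + 1)) (KInvStep (d := 3) Lc (m + 1))) Lc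
            (unitS₂ (sfStep Lc (m + 1)) (smStep 3 Lc (m + 1)) (T2RecAt 3 Lc (toSite r) cE cVH cΛ cE₂ cB Tc vh₂S (mixFFAt (toSite r) Lc) (m + 1)))) +
        ((fun κ u κ' u' => (cE₂ * (Lc : ℝ) ^ (2 * (3 + 1))) • mmRead Lc (K3OfK (unitK (sfStep Lc (m + 1)) (smStep 3 Lc (m + 1)) (coDressKBmAt (toSite r) Lc (KInvStep (d := 3) Lc (m + 1)))) Lc
            (unitS (sfStep Lc (m + 1)) (smStep 3 Lc (m + 1)) (SpureRecAt 3 Lc (toSite r) cE cVH cΛ (m + 1))) (unitM (sfStep Lc (m + 1)) (smStep 3 Lc (m + 1)) (M1At 3 Lc (toSite r) cΛ (m + 1)))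
            (W2SymOfK (unitK (sfStep Lc (m + 1)) (smStep 3 Lc (m + 1)) (coDressKBmAt (toSite r) Lc (KInvStep (d := 3) Lc (m + 1)))) Lc (unitS (sfStep Lc (m + 1)) (smStep 3 Lc (m + 1)) (SpureRecAt 3 Lc (toSite r) cE cVH cΛ (m + 1)))
              (unitM (sfStep Lc (m + 1)) (smStep 3 Lc (m + 1)) (M1At 3 Lc (toSite r) cΛ (m + 1))) 0 (unitM₂ (sfStep Lc (m + 1)) (smStep 3 Lc (m + 1)) (M2Of 3 Lc (mixFFAt (toSite r) Lc) (m + 1)))) κ u κ' u')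
          + cB • vh₂S κ u κ' u') -
         (fun κ u κ' u' => (cE₂ * (Lc : ℝ) ^ (2 * (3 + 1))) • mmRead Lc (K3OfK (unitK (sfStep Lc (m + 1)) (smStep 3 Lc (m + 1)) (KInvStep (d := 3) Lc (m + 1))) Lc
            (unitS (sfStep Lc (m + 1)) (smStep 3 Lc (m + 1)) (SpureRecAt 3 Lc (toSite r) cE cVH cΛ (m + 1))) (unitM (sfStep Lc (m + 1)) (smStep 3 Lc (m + 1)) (M1At 3 Lc (toSite r) cΛ (m + 1)))
            (W2SymOfK (unitK (sfStep Lc (m + 1)) (smStep 3 Lc (m + 1)) (KInvStep (d := 3) Lc (m + 1))) Lc (unitS (sfStep Lc (m + 1)) (smStep 3 Lc (m + 1)) (SpureRecAt 3 Lc (toSite r) cE cVH cΛ (m + 1)))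
              (unitM (sfStep Lc (m + 1)) (smStep 3 Lc (m + 1)) (M1At 3 Lc (toSite r) cΛ (m + 1))) 0 (unitM₂ (sfStep Lc (m + 1)) (smStep 3 Lc (m + 1)) (M2Of 3 Lc (mixFFAt (toSite r) Lc) (m + 1)))) κ u κ' u')
          + cB • vh₂S κ u κ' u')))) -
      (((lin4 (cE₂ * (Lc : ℝ) ^ (2 * (3 + 1))) (unitK (sfStep Lc m) (smStep 3 Lc m) (coDressKBmAt (toSite r) Lc (KInvStep (d := 3) Lc m))) Lc
            (unitS₂ (sfStep Lc m) (smStep 3 Lc m) (T2RecAt 3 Lc (toSite r) cE cVH cΛ cE₂ cB Tc vh₂S (mixFFAt (toSite r) Lc) m)) -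
          lin4 (cE₂ * (Lc : ℝ) ^ (2 * (3 + 1))) (unitK (sfStep Lc m) (smStep 3 Lc m) (KInvStep (d := 3) Lc m)) Lc
            (unitS₂ (sfStep Lc m) (smStep 3 Lc m) (T2RecAt 3 Lc (toSite r) cE cVH cΛ cE₂ cB Tc vh₂S (mixFFAt (toSite r) Lc) m))) +
        ((fun κ u κ' u' => (cE₂ * (Lc : ℝ) ^ (2 * (3 + 1))) • mmRead Lc (K3OfK (unitK (sfStep Lc m) (smStep 3 Lc m) (coDressKBmAt (toSite r) Lc (KInvStep (d := 3) Lc m))) Lc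
            (unitS (sfStep Lc m) (smStep 3 Lc m) (SpureRecAt 3 Lc (toSite r) cE cVH cΛ m)) (unitM (sfStep Lc m) (smStep 3 Lc m) (M1At 3 Lc (toSite r) cΛ m))
            (W2SymOfK (unitK (sfStep Lc m) (smStep 3 Lc m) (coDressKBmAt (toSite r) Lc (KInvStep (d := 3) Lc m))) Lc (unitS (sfStep Lc m) (smStep 3 Lc m) (SpureRecAt 3 Lc (toSite r) cE cVH cΛ m))
              (unitM (sfStep Lc m) (smStep 3 Lc m) (M1At 3 Lc (toSite r) cΛ m)) 0 (unitM₂ (sfStep Lc m) (smStep 3 Lc m) (M2Of 3 Lc (mixFFAt (toSite r) Lc) m))) κ u κ' u')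
          + cB • vh₂S κ u κ' u') -
         (fun κ u κ' u' => (cE₂ * (Lc : ℝ) ^ (2 * (3 + 1))) • mmRead Lc (K3OfK (unitK (sfStep Lc m) (smStep 3 Lc m) (KInvStep (d := 3) Lc m)) Lc
            (unitS (sfStep Lc m) (smStep 3 Lc m) (SpureRecAt 3 Lc (toSite r) cE cVH cΛ m)) (unitM (sfStep Lc m) (smStep 3 Lc m) (M1At 3 Lc (toSite r) cΛ m))
            (W2SymOfK (unitK (sfStep Lc m) (smStep 3 Lc m) (KInvStep (d := 3) Lc m)) Lc (unitS (sfStep Lc m) (smStep 3 Lc m) (SpureRecAt 3 Lc (toSite r) cE cVH cΛ m))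
              (unitM (sfStep Lc m) (smStep 3 Lc m) (M1At 3 Lc (toSite r) cΛ m)) 0 (unitM₂ (sfStep Lc m) (smStep 3 Lc m) (M2Of 3 Lc (mixFFAt (toSite r) Lc) m))) κ u κ' u')
          + cB • vh₂S κ u κ' u'))))) (Ch' * θh ^ m) δh')
    (hθh0 : 0 ≤ θh) (hθh1 : θh < 1) (hδh' : 0 < δh') :
    ∃ Cw cW θW δW : ℝ, 0 ≤ θW ∧ θW < 1 ∧ 0 < δW ∧
      (∀ j : ℕ, VertexFamily₂ (unitW (sfStep Lc j) (smStep 3 Lc j)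
        (WrecAt 3 Lc (toSite r) cE cVH cΛ cE₂ cB Tc vh₂S (mixFFAt (toSite r) Lc) j)) Lc Cw δW) ∧
      (∀ k j : ℕ, VertexFamily₂ (unitW (sfStep Lc (k + j)) (smStep 3 Lc (k + j))
          (WrecAt 3 Lc (toSite r) cE cVH cΛ cE₂ cB Tc vh₂S (mixFFAt (toSite r) Lc) (k + j)) -
        unitW (sfStep Lc k) (smStep 3 Lc k) (WrecAt 3 Lc (toSite r) cE cVH cΛ cE₂ cB Tc vh₂S (mixFFAt (toSite r) Lc) k)) Lc (cW * θW ^ k) δW) := by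
  obtain ⟨C₂', c₂, θ₂, δ₂', hδ₂', hθ₂0, hθ₂1, hT₂, hT₂d⟩ := exists_hT₂_hT₂d_T2RecAt_three_of_rows hLc hr cE cVH cΛ cE₂ cB Tc hBff hBmm hB hBt hpin hδ₂ hδh hU
    hUd hcU hϑU0 hϑU1 hδU hC hH hHr hθh0 hθh1 hδh'
  exact hW_hWall_WrecAt_three_of_T2 hLc hcE hr cVH cΛ cE₂ cB Tc vh₂S hT₂ hT₂d hδ₂' hθ₂0 hθ₂1

end End

end Summit.QuantumFields.BalabanUV.Beta.GAN24.T2DevConservationDrift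

end
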